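import Literature.Analysis.ODE.ComplexSecondOrder
import HarnessLib

/-!
# Recessive and dominant solutions of `y'' = Q(t) y` at infinity, for complex `Q` with
# `re Q ≥ γ² > 0`: an elementary exponential dichotomy

Topic `Literature/Analysis/ODE` (namespace `Literature.Analysis.ODE`), continuing
`ComplexSecondOrder.lean`. For a solution `y` of `y'' = Q y` on `(r₀, ∞)` with `re Q(t) ≥ γ²`
for `t ≥ r₁` (`𝕜 = ℝ` or `ℂ`; no smallness, integrability or asymptotic assumption on `Q`),
the **dichotomy energy** `E_γ(t) = (‖y‖²)' + √2 γ ‖y‖² = 2 re(ȳ y') + √2 γ ‖y‖²` satisfies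
`E_γ' = 2‖y'‖² + 2 re Q ‖y‖² + √2 γ (‖y‖²)' ≥ √2 γ E_γ`, whence (everything proved):

* `IsSol2.dichotomy` — either `E_γ ≤ 0` on `[r₁, ∞)`, and then `e^{√2γt}‖y‖²` is nonincreasing
  (`antitoneOn_exp_mul_normSq`, `normSq_le_of_solEnergy_nonpos`: **exponential decay**), or
  `E_γ(t₀) > 0` somewhere and then `‖y t‖² ≥ c e^{√2 γ t}` for all large `t`
  (`normSq_ge_of_solEnergy_pos`, `exists_exp_growth`: **exponential growth**); a bounded solution
  is in the first case (`solEnergy_nonpos_of_bounded`);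
* `exists_recessive` — a **recessive solution** (`E_γ ≤ 0` on `[r₁, ∞)`, non-zero data at `r₁`)
  exists: normalised solutions vanishing at `T` have `E_γ ≤ 0` up to `T`
  (`solEnergy_nonpos_of_le`), and a subsequential limit of their data as `T → ∞` works;
* `wronskian_eq_zero_of_recessive` — the recessive solutions form a line (two of them have zero
  Wronskian: else all solutions would decay, but the solution with data `(1, 1)` grows), and
  `exists_solEnergy_pos_of_wronskian_ne_zero` — every solution off that line grows;
* `norm_deriv_le_of_bound`, `recessive_decay` — with `‖Q‖ ≤ K` on `[r₁, ∞)` the derivative of a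
  recessive solution decays at the same exponential rate (`√2 γ / 2`).

This is the (weaker-rate, assumption-free) form of the classical dichotomy for
`y'' = (γ² + o(1)) y` (Hartman, Ch. XI §6 (principal solutions), Ch. X §17; for the radial
Klein–Gordon equation on Kerr, Shlapentokh-Rothman, CMP 329 (2014), App. C: "all solutions are
either exponentially growing or exponentially decaying at infinity"), sufficient for shooting and
matching arguments; the optimal rate `γ` and asymptotic expansions are deliberately not pursued.

## References
* P. Hartman, *Ordinary Differential Equations*, Classics in Applied Mathematics 38 (SIAM 2002),
  Ch. XI §6 (Thm. 6.4, Cor. 6.4: principal / non-principal solutions), Ch. X §17. Key `Hartman2002`.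
* Y. Shlapentokh-Rothman, Comm. Math. Phys. 329 (2014) 859–891, §3.1, §4.2, App. C.
  Key `ShlapentokhRothman2014KleinGordon`.
-/

noncomputable section

open Set Metric Filter
open scoped Topology ComplexConjugate NNReal

/-! ## The energy `E_γ = 2 re(ȳ y') + √2 γ ‖y‖²` and the exponential dichotomy -/

namespace Literature.Analysis.ODE

variable {𝕜 : Type*} [RCLike 𝕜]

/-- The **dichotomy energy** `E_γ(t) = 2 re (conj (y t) · y' t) + √2 γ ‖y t‖²`
(`= (‖y‖²)' + √2 γ ‖y‖²` along a solution). Along a solution of `y'' = Q y` with `re Q ≥ γ²` it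
satisfies `E' ≥ √2 γ E`, which drives the exponential dichotomy below. [folklore] -/
def solEnergy (γ : ℝ) (y y' : ℝ → 𝕜) (t : ℝ) : ℝ :=
  2 * RCLike.re (conj (y t) * y' t) + Real.sqrt 2 * γ * ‖y t‖ ^ 2

/-- At a zero of `y` the energy vanishes. [folklore] -/
theorem solEnergy_eq_zero_of_eq_zero (γ : ℝ) {y y' : ℝ → 𝕜} {t : ℝ} (h : y t = 0) :
    solEnergy γ y y' t = 0 := by
  simp [solEnergy, h]

/-- The energy of a combination `a y + b z` is a continuous function of `(a, b)`. [folklore] -/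
theorem continuous_solEnergy_combination (γ : ℝ) (y y' z z' : ℝ → 𝕜) (t : ℝ) :
    Continuous fun p : 𝕜 × 𝕜 ↦
      solEnergy γ (fun s ↦ p.1 * y s + p.2 * z s) (fun s ↦ p.1 * y' s + p.2 * z' s) t := by
  have hc : Continuous fun p : 𝕜 × 𝕜 ↦ conj (p.1 * y t + p.2 * z t) * (p.1 * y' t + p.2 * z' t) :=
    (RCLike.continuous_conj.comp (by fun_prop)).mul (by fun_prop)
  have hn : Continuous fun p : 𝕜 × 𝕜 ↦ ‖p.1 * y t + p.2 * z t‖ ^ 2 :=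
    (continuous_norm.comp (by fun_prop)).pow 2
  simp only [solEnergy]
  exact (continuous_const.mul (RCLike.continuous_re.comp hc)).add (continuous_const.mul hn)

/-- With data `y t = 1`, `y' t = 1` and `γ ≥ 0` the energy is positive (`= 2 + √2 γ`). [folklore] -/
theorem solEnergy_pos_of_data {γ : ℝ} (hγ : 0 ≤ γ) {y y' : ℝ → 𝕜} {t : ℝ} (h0 : y t = 1)
    (h1 : y' t = 1) : 0 < solEnergy γ y y' t := by
  simp only [solEnergy, h0, h1, map_one, mul_one, RCLike.one_re, norm_one, one_pow]
  positivity

namespace IsSol2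

variable {Q : ℝ → 𝕜} {y y' z z' : ℝ → 𝕜} {s : Set ℝ} {r₀ r₁ γ : ℝ}

/-- Along a solution, `E_γ' = 2(‖y'‖² + re Q ‖y‖²) + √2 γ · 2 re(ȳ y')`. [folklore] -/
theorem hasDerivAt_solEnergy (hy : IsSol2 Q y y' s) (γ : ℝ) {t : ℝ} (ht : t ∈ s) :
    HasDerivAt (solEnergy γ y y')
      (2 * (‖y' t‖ ^ 2 + RCLike.re (Q t) * ‖y t‖ ^ 2) +
        Real.sqrt 2 * γ * (2 * RCLike.re (conj (y t) * y' t))) t :=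
  ((hy.hasDerivAt_reInner ht).const_mul 2).add ((hy.hasDerivAt_normSq ht).const_mul _)

/-- The differential inequality `√2 γ E_γ ≤ E_γ'` where `re Q ≥ γ²`. [folklore] -/
theorem sqrt_two_mul_solEnergy_le (y y' : ℝ → 𝕜) {γ : ℝ} {q : 𝕜} {t : ℝ}
    (hq : γ ^ 2 ≤ RCLike.re q) :
    Real.sqrt 2 * γ * solEnergy γ y y' t ≤
      2 * (‖y' t‖ ^ 2 + RCLike.re q * ‖y t‖ ^ 2) +
        Real.sqrt 2 * γ * (2 * RCLike.re (conj (y t) * y' t)) := by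
  unfold solEnergy
  have h2 : Real.sqrt 2 * Real.sqrt 2 = 2 := Real.mul_self_sqrt zero_le_two
  have hy0 : 0 ≤ ‖y t‖ ^ 2 := by positivity
  have hy1 : 0 ≤ ‖y' t‖ ^ 2 := by positivity
  have hprod : γ ^ 2 * ‖y t‖ ^ 2 ≤ RCLike.re q * ‖y t‖ ^ 2 := mul_le_mul_of_nonneg_right hq hy0
  have key : Real.sqrt 2 * γ * (Real.sqrt 2 * γ * ‖y t‖ ^ 2) = 2 * (γ ^ 2 * ‖y t‖ ^ 2) := by
    rw [show Real.sqrt 2 * γ * (Real.sqrt 2 * γ * ‖y t‖ ^ 2) =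
      (Real.sqrt 2 * Real.sqrt 2) * (γ ^ 2 * ‖y t‖ ^ 2) by ring, h2]
  rw [mul_add, key]
  linarith

/-- **`e^{−√2 γ t} E_γ(t)` is nondecreasing on `[r₁, ∞)`** for a solution on `(r₀, ∞) ⊃ [r₁, ∞)`
with `re Q ≥ γ²` on `[r₁, ∞)`. [folklore] -/
theorem monotoneOn_exp_mul_solEnergy (hy : IsSol2 Q y y' (Ioi r₀)) (hr : r₀ < r₁)
    (hQ : ∀ t, r₁ ≤ t → γ ^ 2 ≤ RCLike.re (Q t)) :
    MonotoneOn (fun t ↦ Real.exp (-(Real.sqrt 2 * γ) * t) * solEnergy γ y y' t) (Ici r₁) := by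
  have hd : ∀ t, r₁ ≤ t → HasDerivAt
      (fun t ↦ Real.exp (-(Real.sqrt 2 * γ) * t) * solEnergy γ y y' t)
      (Real.exp (-(Real.sqrt 2 * γ) * t) *
        ((2 * (‖y' t‖ ^ 2 + RCLike.re (Q t) * ‖y t‖ ^ 2) +
          Real.sqrt 2 * γ * (2 * RCLike.re (conj (y t) * y' t))) -
          Real.sqrt 2 * γ * solEnergy γ y y' t)) t := by
    intro t ht
    have h1 : HasDerivAt (fun t ↦ Real.exp (-(Real.sqrt 2 * γ) * t))
        (Real.exp (-(Real.sqrt 2 * γ) * t) * (-(Real.sqrt 2 * γ))) t := by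
      have h := ((hasDerivAt_id t).const_mul (-(Real.sqrt 2 * γ))).exp
      simp only [id_eq, mul_one] at h
      exact h
    have h2 := hy.hasDerivAt_solEnergy γ (show t ∈ Ioi r₀ from hr.trans_le ht)
    exact (h1.mul h2).congr_deriv (by ring)
  refine monotoneOn_of_deriv_nonneg (convex_Ici r₁)
    (fun t ht ↦ (hd t ht).continuousAt.continuousWithinAt)
    (fun t ht ↦ (hd t (le_of_lt (by simpa using ht))).differentiableAt.differentiableWithinAt)
    fun t ht ↦ ?_
  rw [interior_Ici] at ht
  rw [(hd t (le_of_lt ht)).deriv]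
  exact mul_nonneg (Real.exp_pos _).le
    (sub_nonneg.2 (sqrt_two_mul_solEnergy_le y y' (hQ t (le_of_lt ht))))

/-- The energy grows at least like `e^{√2 γ (t − t₀)}` once measured:
`E_γ(t₀) e^{√2 γ (t − t₀)} ≤ E_γ(t)` for `r₁ ≤ t₀ ≤ t`. [folklore] -/
theorem solEnergy_mul_exp_le (hy : IsSol2 Q y y' (Ioi r₀)) (hr : r₀ < r₁)
    (hQ : ∀ t, r₁ ≤ t → γ ^ 2 ≤ RCLike.re (Q t)) {t₀ t : ℝ} (ht₀ : r₁ ≤ t₀) (ht : t₀ ≤ t) :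
    solEnergy γ y y' t₀ * Real.exp (Real.sqrt 2 * γ * (t - t₀)) ≤ solEnergy γ y y' t := by
  set κ : ℝ := Real.sqrt 2 * γ with hκ
  have h := hy.monotoneOn_exp_mul_solEnergy hr hQ (show r₁ ≤ t₀ from ht₀) (ht₀.trans ht) ht
  dsimp only at h
  have hpos := Real.exp_pos (κ * t)
  have h' := mul_le_mul_of_nonneg_right h hpos.le
  have e1 : Real.exp (-κ * t₀) * Real.exp (κ * t) = Real.exp (κ * (t - t₀)) := by
    rw [← Real.exp_add]; ring_nf
  have e2 : Real.exp (-κ * t) * Real.exp (κ * t) = 1 := by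
    rw [← Real.exp_add, show -κ * t + κ * t = 0 by ring, Real.exp_zero]
  calc solEnergy γ y y' t₀ * Real.exp (κ * (t - t₀))
      = Real.exp (-κ * t₀) * solEnergy γ y y' t₀ * Real.exp (κ * t) := by rw [← e1]; ring
    _ ≤ Real.exp (-κ * t) * solEnergy γ y y' t * Real.exp (κ * t) := h'
    _ = solEnergy γ y y' t := by
        rw [mul_comm (Real.exp _) (solEnergy _ _ _ _), mul_assoc, e2, mul_one]

/-- If the energy is `≤ 0` at some `T`, it is `≤ 0` at every earlier `t ∈ [r₁, T]`. In particular
the solution vanishing at `T` (a "Dirichlet solution") has `E_γ ≤ 0` on `[r₁, T]`. [folklore] -/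
theorem solEnergy_nonpos_of_le (hy : IsSol2 Q y y' (Ioi r₀)) (hr : r₀ < r₁)
    (hQ : ∀ t, r₁ ≤ t → γ ^ 2 ≤ RCLike.re (Q t)) {t T : ℝ} (ht : r₁ ≤ t) (htT : t ≤ T)
    (hT : solEnergy γ y y' T ≤ 0) : solEnergy γ y y' t ≤ 0 := by
  by_contra h
  push Not at h
  have h1 := hy.solEnergy_mul_exp_le hr hQ ht htT
  have : 0 < solEnergy γ y y' t * Real.exp (Real.sqrt 2 * γ * (T - t)) :=
    mul_pos h (Real.exp_pos _)
  linarith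

/-- **Growth alternative.** If `E_γ(t₀) > 0` at some `t₀ ≥ r₁` (`γ > 0`), then for `t ≥ t₀`
`‖y t‖² ≥ (E_γ(t₀) e^{−√2γ t₀} / (2√2γ)) (e^{√2γ t} − e^{√2γ (2t₀ − t)})`: the solution grows like
`e^{γ t/√2}` (the auxiliary function `e^{√2γ t}‖y‖² − (E_γ(t₀)e^{−√2γt₀}/(2√2γ)) e^{2√2γ t}` is
nondecreasing). [folklore] -/
theorem normSq_ge_of_solEnergy_pos (hy : IsSol2 Q y y' (Ioi r₀)) (hr : r₀ < r₁) (hγ : 0 < γ)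
    (hQ : ∀ t, r₁ ≤ t → γ ^ 2 ≤ RCLike.re (Q t)) {t₀ : ℝ} (ht₀ : r₁ ≤ t₀) {t : ℝ} (ht : t₀ ≤ t) :
    solEnergy γ y y' t₀ * Real.exp (-(Real.sqrt 2 * γ) * t₀) / (2 * (Real.sqrt 2 * γ)) *
        (Real.exp (Real.sqrt 2 * γ * t) - Real.exp (Real.sqrt 2 * γ * (2 * t₀ - t))) ≤
      ‖y t‖ ^ 2 := by
  set κ : ℝ := Real.sqrt 2 * γ with hκ
  have hκ0 : 0 < κ := by positivity
  set E₀ : ℝ := solEnergy γ y y' t₀ with hE₀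
  set c : ℝ := E₀ * Real.exp (-κ * t₀) / (2 * κ) with hc
  -- the auxiliary function and its derivative
  set G : ℝ → ℝ := fun s ↦ Real.exp (κ * s) * ‖y s‖ ^ 2 - c * Real.exp (2 * κ * s) with hG
  have hd : ∀ s, r₁ ≤ s → HasDerivAt G
      (Real.exp (κ * s) * solEnergy γ y y' s - c * (2 * κ) * Real.exp (2 * κ * s)) s := by
    intro s hs
    have hs' : s ∈ Ioi r₀ := hr.trans_le hs
    have h1 : HasDerivAt (fun s ↦ Real.exp (κ * s)) (Real.exp (κ * s) * κ) s := by
      have h := ((hasDerivAt_id s).const_mul κ).exp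
      simp only [id_eq, mul_one] at h
      exact h
    have h2 : HasDerivAt (fun s ↦ Real.exp (2 * κ * s)) (Real.exp (2 * κ * s) * (2 * κ)) s := by
      have h := ((hasDerivAt_id s).const_mul (2 * κ)).exp
      simp only [id_eq, mul_one] at h
      exact h
    have h3 := (h1.mul (hy.hasDerivAt_normSq hs')).sub (h2.const_mul c)
    refine h3.congr_deriv ?_
    simp only [solEnergy, hκ]
    ring
  -- monotonicity of `G` on `[t₀, ∞)`
  have hmono : MonotoneOn G (Ici t₀) := by
    refine monotoneOn_of_deriv_nonneg (convex_Ici t₀)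
      (fun s hs ↦ (hd s (ht₀.trans hs)).continuousAt.continuousWithinAt)
      (fun s hs ↦ (hd s (ht₀.trans (le_of_lt (by simpa using hs)))).differentiableAt.differentiableWithinAt)
      fun s hs ↦ ?_
    rw [interior_Ici] at hs
    have hs' : t₀ ≤ s := le_of_lt hs
    rw [(hd s (ht₀.trans hs')).deriv, sub_nonneg]
    have hE := hy.solEnergy_mul_exp_le hr hQ ht₀ hs'
    have hexp : c * (2 * κ) * Real.exp (2 * κ * s) =
        Real.exp (κ * s) * (E₀ * Real.exp (κ * (s - t₀))) := by
      have hne : (2 * κ) ≠ 0 := by positivity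
      rw [hc, div_mul_cancel₀ _ hne, mul_assoc, ← Real.exp_add,
        show Real.exp (κ * s) * (E₀ * Real.exp (κ * (s - t₀))) =
          E₀ * (Real.exp (κ * s) * Real.exp (κ * (s - t₀))) by ring, ← Real.exp_add]
      ring_nf
    rw [hexp]
    exact mul_le_mul_of_nonneg_left hE (Real.exp_pos _).le
  have hGt := hmono Set.self_mem_Ici (Set.mem_Ici.2 ht) ht
  -- unpack `G t₀ ≤ G t`
  simp only [hG] at hGt
  have hy0 : 0 ≤ Real.exp (κ * t₀) * ‖y t₀‖ ^ 2 := by positivity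
  have hpos := Real.exp_pos (κ * t)
  have key : c * Real.exp (2 * κ * t) - c * Real.exp (2 * κ * t₀) ≤ Real.exp (κ * t) * ‖y t‖ ^ 2 := by
    linarith
  have e1 : Real.exp (2 * κ * t) = Real.exp (κ * t) * Real.exp (κ * t) := by
    rw [← Real.exp_add]; ring_nf
  have e2 : Real.exp (2 * κ * t₀) = Real.exp (κ * t) * Real.exp (κ * (2 * t₀ - t)) := by
    rw [← Real.exp_add]; ring_nf
  rw [e1, e2] at key
  have key' : Real.exp (κ * t) * (c * (Real.exp (κ * t) - Real.exp (κ * (2 * t₀ - t)))) ≤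
      Real.exp (κ * t) * ‖y t‖ ^ 2 := by linarith
  exact le_of_mul_le_mul_left key' hpos

/-- **Growth alternative, clean form**: if `E_γ(t₀) > 0` at some `t₀ ≥ r₁` (`γ > 0`) then there
is `c > 0` with `c e^{√2 γ t} ≤ ‖y t‖²` for all `t ≥ t₀ + 1`. [folklore] -/
theorem exists_exp_growth (hy : IsSol2 Q y y' (Ioi r₀)) (hr : r₀ < r₁) (hγ : 0 < γ)
    (hQ : ∀ t, r₁ ≤ t → γ ^ 2 ≤ RCLike.re (Q t)) {t₀ : ℝ} (ht₀ : r₁ ≤ t₀)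
    (hE : 0 < solEnergy γ y y' t₀) :
    ∃ c : ℝ, 0 < c ∧ ∀ t, t₀ + 1 ≤ t → c * Real.exp (Real.sqrt 2 * γ * t) ≤ ‖y t‖ ^ 2 := by
  set κ : ℝ := Real.sqrt 2 * γ with hκ
  have hκ0 : 0 < κ := by positivity
  set A : ℝ := solEnergy γ y y' t₀ * Real.exp (-κ * t₀) / (2 * κ) with hA
  have hA0 : 0 < A := by positivity
  refine ⟨A * (1 - Real.exp (-(2 * κ))), mul_pos hA0 (by
    rw [sub_pos]; exact Real.exp_lt_one_iff.2 (by linarith)), fun t ht ↦ ?_⟩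
  have h := hy.normSq_ge_of_solEnergy_pos hr hγ hQ ht₀ (show t₀ ≤ t by linarith)
  rw [← hκ, ← hA] at h
  refine le_trans ?_ h
  have e1 : Real.exp (κ * (2 * t₀ - t)) = Real.exp (κ * t) * Real.exp (-(2 * κ) * (t - t₀)) := by
    rw [← Real.exp_add]; ring_nf
  rw [e1, mul_assoc]
  refine mul_le_mul_of_nonneg_left ?_ hA0.le
  have hexp : Real.exp (-(2 * κ) * (t - t₀)) ≤ Real.exp (-(2 * κ)) := by
    rw [Real.exp_le_exp]; nlinarith
  nlinarith [Real.exp_pos (κ * t)]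

/-- **Decay alternative**: if `E_γ ≤ 0` on `[r₁, ∞)` then `e^{√2 γ t} ‖y t‖²` is nonincreasing
there. [folklore] -/
theorem antitoneOn_exp_mul_normSq (hy : IsSol2 Q y y' (Ioi r₀)) (hr : r₀ < r₁)
    (hE : ∀ t, r₁ ≤ t → solEnergy γ y y' t ≤ 0) :
    AntitoneOn (fun t ↦ Real.exp (Real.sqrt 2 * γ * t) * ‖y t‖ ^ 2) (Ici r₁) := by
  set κ : ℝ := Real.sqrt 2 * γ with hκ
  have hd : ∀ s, r₁ ≤ s → HasDerivAt (fun t ↦ Real.exp (κ * t) * ‖y t‖ ^ 2)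
      (Real.exp (κ * s) * solEnergy γ y y' s) s := by
    intro s hs
    have h1 : HasDerivAt (fun s ↦ Real.exp (κ * s)) (Real.exp (κ * s) * κ) s := by
      have h := ((hasDerivAt_id s).const_mul κ).exp
      simp only [id_eq, mul_one] at h
      exact h
    refine (h1.mul (hy.hasDerivAt_normSq (hr.trans_le hs))).congr_deriv ?_
    simp only [solEnergy, hκ]
    ring
  refine antitoneOn_of_deriv_nonpos (convex_Ici r₁)
    (fun s hs ↦ (hd s hs).continuousAt.continuousWithinAt)
    (fun s hs ↦ (hd s (le_of_lt (by simpa using hs))).differentiableAt.differentiableWithinAt)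
    fun s hs ↦ ?_
  rw [interior_Ici] at hs
  rw [(hd s (le_of_lt hs)).deriv]
  exact mul_nonpos_of_nonneg_of_nonpos (Real.exp_pos _).le (hE s (le_of_lt hs))

/-- **Decay alternative, clean form**: if `E_γ ≤ 0` on `[r₁, ∞)` then
`‖y t‖² ≤ ‖y t₁‖² e^{−√2 γ (t − t₁)}` for `r₁ ≤ t₁ ≤ t`. [folklore] -/
theorem normSq_le_of_solEnergy_nonpos (hy : IsSol2 Q y y' (Ioi r₀)) (hr : r₀ < r₁)
    (hE : ∀ t, r₁ ≤ t → solEnergy γ y y' t ≤ 0) {t₁ t : ℝ} (ht₁ : r₁ ≤ t₁) (ht : t₁ ≤ t) :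
    ‖y t‖ ^ 2 ≤ ‖y t₁‖ ^ 2 * Real.exp (-(Real.sqrt 2 * γ) * (t - t₁)) := by
  have h := hy.antitoneOn_exp_mul_normSq hr hE (Set.mem_Ici.2 ht₁) (Set.mem_Ici.2 (ht₁.trans ht)) ht
  dsimp only at h
  have hpos := Real.exp_pos (Real.sqrt 2 * γ * t)
  have e1 : Real.exp (Real.sqrt 2 * γ * t₁) =
      Real.exp (Real.sqrt 2 * γ * t) * Real.exp (-(Real.sqrt 2 * γ) * (t - t₁)) := by
    rw [← Real.exp_add]; ring_nf
  have key : Real.exp (Real.sqrt 2 * γ * t) * ‖y t‖ ^ 2 ≤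
      Real.exp (Real.sqrt 2 * γ * t) * (‖y t₁‖ ^ 2 * Real.exp (-(Real.sqrt 2 * γ) * (t - t₁))) :=
    calc _ ≤ Real.exp (Real.sqrt 2 * γ * t₁) * ‖y t₁‖ ^ 2 := h
      _ = _ := by rw [e1]; ring
  exact le_of_mul_le_mul_left key hpos

/-- **The dichotomy.** For a solution on `(r₀, ∞)` with `re Q ≥ γ² > 0` on `[r₁, ∞)`: either
`E_γ ≤ 0` on `[r₁, ∞)` (and then `‖y‖` decays exponentially), or `‖y t‖² ≥ c e^{√2 γ t}` for all
large `t`, some `c > 0`. [folklore] -/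
theorem dichotomy (hy : IsSol2 Q y y' (Ioi r₀)) (hr : r₀ < r₁) (hγ : 0 < γ)
    (hQ : ∀ t, r₁ ≤ t → γ ^ 2 ≤ RCLike.re (Q t)) :
    (∀ t, r₁ ≤ t → solEnergy γ y y' t ≤ 0) ∨
      ∃ t₀ c : ℝ, r₁ ≤ t₀ ∧ 0 < c ∧ ∀ t, t₀ ≤ t → c * Real.exp (Real.sqrt 2 * γ * t) ≤ ‖y t‖ ^ 2 := by
  by_cases h : ∀ t, r₁ ≤ t → solEnergy γ y y' t ≤ 0
  · exact Or.inl h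
  · push Not at h
    obtain ⟨t₀, ht₀, hE⟩ := h
    obtain ⟨c, hc, hgrow⟩ := hy.exists_exp_growth hr hγ hQ ht₀ hE
    exact Or.inr ⟨t₀ + 1, c, by linarith, hc, hgrow⟩

/-- A **bounded** solution has `E_γ ≤ 0` on `[r₁, ∞)` (the growth alternative is excluded).
[folklore] -/
theorem solEnergy_nonpos_of_bounded (hy : IsSol2 Q y y' (Ioi r₀)) (hr : r₀ < r₁) (hγ : 0 < γ)
    (hQ : ∀ t, r₁ ≤ t → γ ^ 2 ≤ RCLike.re (Q t)) {C : ℝ} (hC : ∀ t, r₁ ≤ t → ‖y t‖ ≤ C) :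
    ∀ t, r₁ ≤ t → solEnergy γ y y' t ≤ 0 := by
  rcases hy.dichotomy hr hγ hQ with h | ⟨t₀, c, ht₀, hc, hgrow⟩
  · exact h
  · exfalso
    -- `c e^{κ t} ≤ C²` for all `t ≥ t₀` is absurd
    set κ : ℝ := Real.sqrt 2 * γ with hκ
    have hκ0 : 0 < κ := by positivity
    have hC0 : 0 ≤ C := (norm_nonneg _).trans (hC t₀ ht₀)
    obtain ⟨t, ht⟩ : ∃ t, max t₀ 0 ≤ t ∧ C ^ 2 / c < Real.exp (κ * t) := by
      obtain ⟨t, ht⟩ := ((Real.tendsto_exp_atTop.comp (tendsto_id.const_mul_atTop hκ0)).eventually_gt_atTop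
        (C ^ 2 / c)).exists_forall_of_atTop
      exact ⟨max t (max t₀ 0), le_max_right _ _, by simpa using ht _ (le_max_left _ _)⟩
    have h1 := hgrow t ((le_max_left _ _).trans ht.1)
    have h2 : ‖y t‖ ^ 2 ≤ C ^ 2 := by
      have := hC t (ht₀.trans ((le_max_left _ _).trans ht.1))
      nlinarith [norm_nonneg (y t)]
    have h3 : C ^ 2 < c * Real.exp (κ * t) := (div_lt_iff₀' hc).1 ht.2
    linarith

/-! ## Recessive solutions: existence, uniqueness, dominant complements -/

/-- **Existence of a recessive solution** (`Q` continuous on `(r₀, ∞)`, `re Q ≥ γ²` on `[r₁, ∞)`,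
any real `γ`): there is a solution with data of norm `1` at `r₁` and `E_γ ≤ 0` on `[r₁, ∞)`. It is the
limit of normalised solutions vanishing at `T → ∞` (each of which has `E_γ ≤ 0` up to `T`),
along a subsequence for which the data converge (Hartman, Ch. XI §6, the construction of
principal solutions, Cor. 6.4, in the complex-coefficient setting). [cite: Hartman2002, Ch. XI Cor. 6.4] -/
theorem exists_recessive {Q : ℝ → 𝕜} {r₀ r₁ γ : ℝ} (hQc : ContinuousOn Q (Ioi r₀)) (hr : r₀ < r₁)
    (hQ : ∀ t, r₁ ≤ t → γ ^ 2 ≤ RCLike.re (Q t)) :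
    ∃ y y' : ℝ → 𝕜, IsSol2 Q y y' (Ioi r₀) ∧ ‖(y r₁, y' r₁)‖ = 1 ∧
      ∀ t, r₁ ≤ t → solEnergy γ y y' t ≤ 0 := by
  -- a basis at `r₁`
  obtain ⟨y₁, y₁', h₁, h₁0, h₁1⟩ := exists_isSol2_Ioi hQc r₁ (1 : 𝕜) 0
  obtain ⟨y₂, y₂', h₂, h₂0, h₂1⟩ := exists_isSol2_Ioi hQc r₁ (0 : 𝕜) 1
  have hW : ∀ T, r₀ < T → wronskian y₁ y₁' y₂ y₂' T = 1 := fun T hT ↦ by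
    rw [h₁.wronskian_eq h₂ hT hr]
    simp [wronskian, h₁0, h₁1, h₂0, h₂1]
  -- the normalised coefficient vectors of the solutions vanishing at `T n = r₁ + n + 1`
  set T : ℕ → ℝ := fun n ↦ r₁ + n + 1 with hT
  have hTr : ∀ n, r₀ < T n := fun n ↦ by simp [hT]; linarith [(n.cast_nonneg : (0 : ℝ) ≤ n)]
  set v : ℕ → 𝕜 × 𝕜 := fun n ↦ (y₂ (T n), -y₁ (T n)) with hv
  have hv0 : ∀ n, v n ≠ 0 := by
    intro n hn
    have h1 : y₂ (T n) = 0 := by simpa [hv] using congrArg Prod.fst hn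
    have h2 : y₁ (T n) = 0 := by simpa [hv] using congrArg Prod.snd hn
    have := hW (T n) (hTr n)
    simp [wronskian, h1, h2] at this
  set u : ℕ → 𝕜 × 𝕜 := fun n ↦ (‖v n‖⁻¹ : 𝕜) • v n with hu
  have hu1 : ∀ n, ‖u n‖ = 1 := fun n ↦ by
    rw [hu]
    dsimp only
    rw [norm_smul, norm_inv, RCLike.norm_ofReal, abs_norm, inv_mul_cancel₀ (norm_ne_zero_iff.2 (hv0 n))]
  -- the combination with coefficients `p`
  set comb : 𝕜 × 𝕜 → ℝ → 𝕜 := fun p s ↦ p.1 * y₁ s + p.2 * y₂ s with hcomb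
  set comb' : 𝕜 × 𝕜 → ℝ → 𝕜 := fun p s ↦ p.1 * y₁' s + p.2 * y₂' s with hcomb'
  have hsol : ∀ p, IsSol2 Q (comb p) (comb' p) (Ioi r₀) := fun p ↦ h₁.combination h₂ p.1 p.2
  -- the `n`-th combination vanishes at `T n`, hence has `E ≤ 0` on `[r₁, T n]`
  have hvan : ∀ n, comb (u n) (T n) = 0 := fun n ↦ by
    simp only [hcomb, hu, hv, Prod.smul_fst, Prod.smul_snd, smul_eq_mul]
    ring
  have hEn : ∀ n t, r₁ ≤ t → t ≤ T n → solEnergy γ (comb (u n)) (comb' (u n)) t ≤ 0 :=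
    fun n t ht htT ↦ (hsol (u n)).solEnergy_nonpos_of_le hr hQ ht htT
      (le_of_eq (solEnergy_eq_zero_of_eq_zero γ (hvan n)))
  -- a convergent subsequence of the coefficients
  obtain ⟨p, hp, φ, hφ, hlim⟩ := (isCompact_sphere (0 : 𝕜 × 𝕜) 1).tendsto_subseq
    (x := u) (fun n ↦ mem_sphere_zero_iff_norm.2 (hu1 n))
  have hp1 : ‖p‖ = 1 := mem_sphere_zero_iff_norm.1 hp
  refine ⟨comb p, comb' p, hsol p, ?_, fun t ht ↦ ?_⟩
  · simp only [hcomb, hcomb', h₁0, h₁1, h₂0, h₂1, mul_one, mul_zero, add_zero, zero_add]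
    exact hp1
  · -- `E(comb p)(t) = lim E(comb (u (φ n)))(t) ≤ 0`
    have hcont := continuous_solEnergy_combination γ y₁ y₁' y₂ y₂' t
    have hlimE := (hcont.tendsto p).comp hlim
    refine le_of_tendsto hlimE (Filter.eventually_atTop.2 ⟨Nat.ceil (t - r₁), fun n hn ↦ ?_⟩)
    simp only [Function.comp_def]
    refine hEn (φ n) t ht ?_
    have hφn : (n : ℝ) ≤ φ n := by exact_mod_cast hφ.le_apply
    have : t - r₁ ≤ n := (Nat.le_ceil _).trans (by exact_mod_cast hn)
    simp only [hT]
    linarith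

/-- **Uniqueness of the recessive direction.** Two solutions with `E_γ ≤ 0` on `[r₁, ∞)`
(`re Q ≥ γ² > 0` there) have vanishing Wronskian: otherwise they would span all solutions, every
solution would decay, contradicting the growth of the solution with data `(1, 1)` at `r₁`.
[cite: Hartman2002, Ch. XI Thm. 6.4] -/
theorem wronskian_eq_zero_of_recessive (hQc : ContinuousOn Q (Ioi r₀)) (hy : IsSol2 Q y y' (Ioi r₀))
    (hz : IsSol2 Q z z' (Ioi r₀)) (hr : r₀ < r₁) (hγ : 0 < γ)
    (hQ : ∀ t, r₁ ≤ t → γ ^ 2 ≤ RCLike.re (Q t))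
    (hEy : ∀ t, r₁ ≤ t → solEnergy γ y y' t ≤ 0) (hEz : ∀ t, r₁ ≤ t → solEnergy γ z z' t ≤ 0) :
    wronskian y y' z z' r₁ = 0 := by
  by_contra hW
  obtain ⟨w, w', hw, hw0, hw1⟩ := exists_isSol2_Ioi hQc r₁ (1 : 𝕜) 1
  obtain ⟨hwc, -⟩ := hy.eq_combination hQc hz hw hr hW
  set a : 𝕜 := wronskian w w' z z' r₁ / wronskian y y' z z' r₁
  set b : 𝕜 := wronskian y y' w w' r₁ / wronskian y y' z z' r₁
  -- `w` is bounded on `[r₁, ∞)`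
  have hyb : ∀ t, r₁ ≤ t → ‖y t‖ ≤ ‖y r₁‖ := fun t ht ↦ by
    have h := hy.normSq_le_of_solEnergy_nonpos hr hEy le_rfl ht
    have hnn : 0 ≤ Real.sqrt 2 * γ * (t - r₁) :=
      mul_nonneg (mul_nonneg (Real.sqrt_nonneg 2) hγ.le) (sub_nonneg.2 ht)
    have he : Real.exp (-(Real.sqrt 2 * γ) * (t - r₁)) ≤ 1 :=
      Real.exp_le_one_iff.2 (by linarith)
    have h2 : ‖y t‖ ^ 2 ≤ ‖y r₁‖ ^ 2 := h.trans (mul_le_of_le_one_right (by positivity) he)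
    exact (pow_le_pow_iff_left₀ (norm_nonneg _) (norm_nonneg _) two_ne_zero).1 h2
  have hzb : ∀ t, r₁ ≤ t → ‖z t‖ ≤ ‖z r₁‖ := fun t ht ↦ by
    have h := hz.normSq_le_of_solEnergy_nonpos hr hEz le_rfl ht
    have hnn : 0 ≤ Real.sqrt 2 * γ * (t - r₁) :=
      mul_nonneg (mul_nonneg (Real.sqrt_nonneg 2) hγ.le) (sub_nonneg.2 ht)
    have he : Real.exp (-(Real.sqrt 2 * γ) * (t - r₁)) ≤ 1 :=
      Real.exp_le_one_iff.2 (by linarith)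
    have h2 : ‖z t‖ ^ 2 ≤ ‖z r₁‖ ^ 2 := h.trans (mul_le_of_le_one_right (by positivity) he)
    exact (pow_le_pow_iff_left₀ (norm_nonneg _) (norm_nonneg _) two_ne_zero).1 h2
  have hwb : ∀ t, r₁ ≤ t → ‖w t‖ ≤ ‖a‖ * ‖y r₁‖ + ‖b‖ * ‖z r₁‖ := fun t ht ↦ by
    rw [hwc (hr.trans_le ht)]
    refine (norm_add_le _ _).trans (add_le_add ?_ ?_) <;> rw [norm_mul]
    · exact mul_le_mul_of_nonneg_left (hyb t ht) (norm_nonneg _)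
    · exact mul_le_mul_of_nonneg_left (hzb t ht) (norm_nonneg _)
  have hEw := hw.solEnergy_nonpos_of_bounded hr hγ hQ hwb r₁ le_rfl
  have hpos := solEnergy_pos_of_data hγ.le hw0 hw1 (γ := γ)
  linarith

/-- **Dominant complement.** If `y` is recessive (`E_γ ≤ 0` on `[r₁, ∞)`) and `w` is a solution
with `W(y, w)(r₁) ≠ 0`, then `E_γ(w)(t₀) > 0` at some `t₀ ≥ r₁`; hence (`exists_exp_growth`) `w`
grows exponentially. [cite: Hartman2002, Ch. XI Thm. 6.4] -/
theorem exists_solEnergy_pos_of_wronskian_ne_zero (hQc : ContinuousOn Q (Ioi r₀))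
    (hy : IsSol2 Q y y' (Ioi r₀)) (hw : IsSol2 Q z z' (Ioi r₀)) (hr : r₀ < r₁) (hγ : 0 < γ)
    (hQ : ∀ t, r₁ ≤ t → γ ^ 2 ≤ RCLike.re (Q t))
    (hEy : ∀ t, r₁ ≤ t → solEnergy γ y y' t ≤ 0) (hW : wronskian y y' z z' r₁ ≠ 0) :
    ∃ t₀, r₁ ≤ t₀ ∧ 0 < solEnergy γ z z' t₀ := by
  by_contra h
  push Not at h
  exact hW (hy.wronskian_eq_zero_of_recessive hQc hw hr hγ hQ hEy h)

/-! ## Decay of the derivative of a recessive solution -/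

/-- **A bound for `y'` by `y` over a unit interval**: if `‖Q‖ ≤ K` on `[t, t + 1]` and
`‖y‖ ≤ M` there, then `‖y' t‖ ≤ (2 + K) M` (two applications of the mean value inequality:
`‖y'(s) − y'(t)‖ ≤ K M` on `[t, t+1]`, then `‖y(t+1) − y(t) − y'(t)‖ ≤ K M`). [folklore] -/
theorem norm_deriv_le_of_bound (hy : IsSol2 Q y y' s) {t K M : ℝ} (hsub : Icc t (t + 1) ⊆ s)
    (hK : ∀ τ ∈ Icc t (t + 1), ‖Q τ‖ ≤ K) (hM : ∀ τ ∈ Icc t (t + 1), ‖y τ‖ ≤ M) :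
    ‖y' t‖ ≤ (2 + K) * M := by
  have hM0 : 0 ≤ M := (norm_nonneg _).trans (hM t ⟨le_rfl, by linarith⟩)
  have hK0 : 0 ≤ K := (norm_nonneg _).trans (hK t ⟨le_rfl, by linarith⟩)
  -- first: `‖y' τ − y' t‖ ≤ K M` on `[t, t + 1]`
  have h1 : ∀ τ ∈ Icc t (t + 1), ‖y' τ - y' t‖ ≤ K * M * (τ - t) := by
    refine norm_image_sub_le_of_norm_deriv_le_segment' (f' := fun τ ↦ Q τ * y τ)
      (fun τ hτ ↦ (hy.hasDerivAt_deriv τ (hsub hτ)).hasDerivWithinAt) fun τ hτ ↦ ?_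
    rw [norm_mul]
    exact mul_le_mul (hK τ (Ico_subset_Icc_self hτ)) (hM τ (Ico_subset_Icc_self hτ))
      (norm_nonneg _) hK0
  -- second: `g τ = y τ − τ • y' t` has `‖g'‖ ≤ K M`
  have h2 : ∀ τ ∈ Icc t (t + 1), ‖(y τ - (τ : 𝕜) * y' t) - (y t - (t : 𝕜) * y' t)‖ ≤ K * M * (τ - t) := by
    refine norm_image_sub_le_of_norm_deriv_le_segment' (f := fun τ ↦ y τ - (τ : 𝕜) * y' t)
      (f' := fun τ ↦ y' τ - y' t) (fun τ hτ ↦ ?_) fun τ hτ ↦ ?_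
    · have hc : HasDerivAt (fun τ : ℝ ↦ (τ : 𝕜) * y' t) (y' t) τ := by
        have h := ((RCLike.ofRealCLM (K := 𝕜)).hasDerivAt (x := τ)).mul_const (y' t)
        simpa using h
      exact ((hy.hasDerivAt τ (hsub hτ)).sub hc).hasDerivWithinAt
    · have := h1 τ (Ico_subset_Icc_self hτ)
      have hτ1 : τ - t ≤ 1 := by linarith [hτ.2.le]
      calc ‖y' τ - y' t‖ ≤ K * M * (τ - t) := this
        _ ≤ K * M * 1 := mul_le_mul_of_nonneg_left hτ1 (mul_nonneg hK0 hM0)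
        _ = K * M := mul_one _
  have h3 := h2 (t + 1) ⟨by linarith, le_rfl⟩
  have hsimp : (y (t + 1) - ((t + 1 : ℝ) : 𝕜) * y' t) - (y t - (t : 𝕜) * y' t) =
      y (t + 1) - y t - y' t := by
    push_cast; ring
  rw [hsimp, show t + 1 - t = (1 : ℝ) by ring, mul_one] at h3
  have h4 : ‖y' t‖ ≤ ‖y (t + 1)‖ + ‖y t‖ + K * M := by
    have := norm_sub_le (y (t + 1) - y t) (y (t + 1) - y t - y' t)
    rw [show y (t + 1) - y t - (y (t + 1) - y t - y' t) = y' t by ring] at this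
    linarith [norm_sub_le (y (t + 1)) (y t)]
  have h5 := hM (t + 1) ⟨by linarith, le_rfl⟩
  have h6 := hM t ⟨le_rfl, by linarith⟩
  nlinarith

/-- **Exponential decay of a recessive solution and of its derivative.** If `E_γ ≤ 0` on
`[r₁, ∞)` and `‖Q‖ ≤ K` there, then for `t ≥ r₁`:
`‖y t‖ ≤ ‖y r₁‖ e^{−(√2 γ/2)(t − r₁)}` and `‖y' t‖ ≤ (2 + K) ‖y r₁‖ e^{−(√2 γ/2)(t − r₁)}`.
[cite: Hartman2002, Ch. XI §6] -/
theorem recessive_decay (hy : IsSol2 Q y y' (Ioi r₀)) (hr : r₀ < r₁) (hγ : 0 ≤ γ)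
    (hE : ∀ t, r₁ ≤ t → solEnergy γ y y' t ≤ 0) {K : ℝ} (hK : ∀ t, r₁ ≤ t → ‖Q t‖ ≤ K) {t : ℝ}
    (ht : r₁ ≤ t) :
    ‖y t‖ ≤ ‖y r₁‖ * Real.exp (-(Real.sqrt 2 * γ / 2) * (t - r₁)) ∧
      ‖y' t‖ ≤ (2 + K) * (‖y r₁‖ * Real.exp (-(Real.sqrt 2 * γ / 2) * (t - r₁))) := by
  -- the bound for `‖y τ‖`, any `τ ≥ r₁`
  have hyτ : ∀ τ, r₁ ≤ τ → ‖y τ‖ ≤ ‖y r₁‖ * Real.exp (-(Real.sqrt 2 * γ / 2) * (τ - r₁)) := by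
    intro τ hτ
    have h := hy.normSq_le_of_solEnergy_nonpos hr hE le_rfl hτ
    have he : Real.exp (-(Real.sqrt 2 * γ) * (τ - r₁)) =
        Real.exp (-(Real.sqrt 2 * γ / 2) * (τ - r₁)) ^ 2 := by
      rw [← Real.exp_nat_mul]
      congr 1
      push_cast
      ring
    rw [he, ← mul_pow] at h
    exact (pow_le_pow_iff_left₀ (norm_nonneg _) (by positivity) two_ne_zero).1 h
  refine ⟨hyτ t ht, ?_⟩
  -- the bound for `‖y' t‖` from the unit interval `[t, t + 1]`
  have hmono : ∀ τ ∈ Icc t (t + 1),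
      ‖y τ‖ ≤ ‖y r₁‖ * Real.exp (-(Real.sqrt 2 * γ / 2) * (t - r₁)) := by
    intro τ hτ
    refine (hyτ τ (ht.trans hτ.1)).trans (mul_le_mul_of_nonneg_left ?_ (norm_nonneg _))
    rw [Real.exp_le_exp]
    have h0 : 0 ≤ Real.sqrt 2 * γ / 2 := by positivity
    have h1 : 0 ≤ Real.sqrt 2 * γ / 2 * (τ - t) := mul_nonneg h0 (sub_nonneg.2 hτ.1)
    linarith
  exact hy.norm_deriv_le_of_bound (fun τ hτ ↦ show τ ∈ Ioi r₀ from hr.trans_le (ht.trans hτ.1))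
    (fun τ hτ ↦ hK τ (ht.trans hτ.1)) hmono

end IsSol2

end Literature.Analysis.ODE
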